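import Summits.NavierStokesRegularity.NavierStokesRegularity.Theorems.QuietScarPocketDoorZoomLimit
import Summits.NavierStokesRegularity.NavierStokesRegularity.Theorems.QuietScarPocketDoorZoomApexAE
import Summits.NavierStokesRegularity.NavierStokesRegularity.Theorems.QuietScarPocketDoorZoomTop
import Summits.NavierStokesRegularity.NavierStokesRegularity.Theorems.QuietScarPocketDoorZoomOffApex
import Summits.NavierStokesRegularity.NavierStokesRegularity.Theorems.QuietScarPocketDoorLegF
import Summits.NavierStokesRegularity.NavierStokesRegularity.Theorems.QuietScarPocketDoorDoor
import Summits.NavierStokesRegularity.NavierStokesRegularity.Theorems.QuietScarPocketDoorFrame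

/-!
# QuietScarPocketDoorZoom — door S31 «QuietScarPocketDoor» (nsreg-p1 g25 ROUND-29 v2.1, texts `r29/Sketch31.lean`
# 363b5766493b6c28; Defs p622283): PK1 `scarPocketZoom_holds : ScarPocketZoom` (F5 of the LEAD skeleton) AND THE DOOR CLOSER

* `scarPocketZoom_holds : ScarPocketZoom` — K1, the class zoom at the pocket scale, assembled from F3 `exists_scarPocket_classZoom`
  (LEAD ns-s30-p1, `…ZoomLimit`), F3b `ae_apex_of_classZoom` (ns-sz-p1, `…ZoomApexAE`), F4a `exists_topCurl_of_classZoom`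
  (ns-imp-p1, `…ZoomTop`), F4b `offApexClassical_of_typeIAncientMild` (nsreg-C26-p1, `…ZoomOffApex`); representative
  `Uc := U`, the smooth Type-I ancient mild limit itself.
* `pvScarPocketRegularity_holds : PVScarPocketRegularity` and `targetScarPocket_holds : TargetScarPocket` — the door, by the
  compositions of `…Door` with LEG F (`terminalTraceAnalytic_holds`, ns-s29-p2 `…LegF`), K2 (`tracelessScarLiouville_holds`, tree)
  and the frame transfer PT (`frameTransferS31_holds`, `…Frame`).

Door S31 is a regularity CRITERION about the terminal vorticity trace of a HYPOTHETICAL one-point Type-I blow-up (a quiet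
vorticity pocket at one scale near the apex is incompatible with blow-up); item 0056 `NoTypeII` and NS regularity are NOT proved
and stay OPEN.
-/

noncomputable section

set_option linter.dupNamespace false

namespace Summit.NavierStokesRegularity.NavierStokesRegularity.Theorems.QuietScarPocketDoor

open MeasureTheory Set Function Filter Topology TopologicalSpace Metric
open scoped NNReal ENNReal Topology
open Literature.Analysis Literature.Analysis.FluidPDE

/-- **PK1 `scarPocketZoom_holds : ScarPocketZoom`** (representative `Uc := U`, the smooth mild limit itself). -/
theorem scarPocketZoom_holds : ScarPocketZoom := by
  intro Cu hCu κ hκ hκ1 hdoor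
  obtain ⟨w, π, Rk, ek, εk, I, e, U, P, H, hRk1, hRk, hcl, hone, hIk, hek1, hek, he, hε0, hε, hpocket,
    hU, hsw, hwg, hIU, hsing, hL3⟩ := exists_scarPocket_classZoom hdoor
  have hUc : ContinuousOn (uncurry U) (Iio (0 : ℝ) ×ˢ univ) := hU.1.continuousOn
  have hapex := ae_apex_of_classZoom hRk hone hUc hL3
  obtain ⟨Ω₀, hΩc, htop, hpk⟩ :=
    exists_topCurl_of_classZoom hCu hκ hκ1 hRk1 hRk hcl hone hIk hek1 hek hε0 hε hpocket hU hsw hwg hIU hL3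
  have hoff := offApexClassical_of_typeIAncientMild hCu hU hapex
  refine ⟨U, P, H, Cu, e, U, Ω₀, hsw, hwg, hIU, hapex, he, hsing, Filter.EventuallyEq.rfl, ?_, hoff, hΩc,
    htop, hpk⟩
  exact hUc.mono (prod_mono Ioo_subset_Iio_self (subset_univ _))

/-- **Door S31 in the Pineau–Vicol frame**: `PVScarPocketRegularity`. -/
theorem pvScarPocketRegularity_holds : PVScarPocketRegularity :=
  pvScarPocketRegularity_of scarPocketZoom_holds terminalTraceAnalytic_holds tracelessScarLiouville_holds

/-- **DOOR S31 `TargetScarPocket` (physical frame)**: a classical Leray–Hopf flow with a one-point Type-I bound at `(x₀,T)`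
whose vorticity is eventually `νε‖x₁−x₀‖⁻²`-small on one pocket `B(x₁, κ‖x₁−x₀‖)` close enough to `x₀` is backward bounded
at `(x₀,T)`.  A regularity CRITERION; NS regularity is NOT proved. -/
theorem targetScarPocket_holds : TargetScarPocket :=
  targetScarPocket_of scarPocketZoom_holds terminalTraceAnalytic_holds frameTransferS31_holds

end Summit.NavierStokesRegularity.NavierStokesRegularity.Theorems.QuietScarPocketDoor

end
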